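import Mathlib
import HarnessLib
import Literature.Combinatorics.SimpleGraph.ChordalTreeDecomposition
import Summits.ValiantsHypothesis.ValiantsHypothesis.Theorems.MonotoneRestorationOrbitRestorationLinearVolumeQPSubThresholdDescentTools

/-!
# Route MonotoneRestoration — aside `OrbitRestorationLinearVolumeQP` (stmt-ValiantsHypothesis-18294):
# ONE-SORTED `k`-LABEL UNFOLDING, part 1/3 — the ELIMINATION-ORDERING CERTIFICATE of a labelled pattern

The crux R1 = `OrbitRestorationLinearVolumeQP` is EQUIVALENT to one-sorted narrowness in EXPRESSION currency
(`OrbitRestorationLinearVolumeQPDiNarrow.orbitRestorationLinearVolumeQP_iff_lvDiNarrow`: every `VP ∩ LV` family is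
eventually the closed polynomial of a ONE-SORTED labelled pattern expression `DiPatternExpr ℂ k` with
`n^k ≤ 2^{(log₂ n + c)^c}`), whereas the registered stub `stub_lvNarrowSpan` of line `birth` and the sub-threshold
descent `SubThresholdDescent.subThreshold_descent` (p827466) speak SPAN currency (spans of homomorphism polynomials
of patterns of bounded TREEWIDTH).  The missing currency change — item (b)/(iii) of the repair census in the
evidence memos `DESCENT-SUBTHRESHOLD-g6.md` / `R1-NORMALFORMS-g2.md` — is the ONE-SORTED `k`-LABEL UNFOLDING

  `∀ e : DiPatternExpr ℂ k,  close n e ∈ span_ℂ {dihom_{D,n} : D a directed looped pattern of treewidth ≤ k - 1}`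

(the expression → span half of "`k` labels = treewidth `k − 1`" for Dawar–Pago–Seppelt's one-sorted graph
algebra, converse currency to K2 `HomPolyClose`).  It is proved in three files:

* this file — the TREEWIDTH CERTIFICATE.  A labelled pattern has vertices `Fin k ⊕ Fin m` (`k` label
  vertices, `m` inner vertices indexed in REVERSE ORDER OF CREATION) and carries `N : Fin m → Finset _`, the
  designated higher neighbours of each inner vertex ("the vertices holding the other labels when it was
  created"): `≤ k - 1` of them (`h1`), all LATER in the elimination order `inner 0 < ⋯ < inner (m-1) < labels`
  (`h2`), containing every higher pattern-neighbour (`h3a`, `h3b`), pairwise designated-adjacent (`h4a`, `h4b`).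
  `treewidth_le_of_certificate`: then `tw ≤ k - 1`, by the ELIMINATION-ORDERING BOUND
  `Literature.Combinatorics.SimpleGraph.treewidth_le_of_forall_ncard_higherAdj_le` (Diestel Cor. 12.3.9) applied
  to the chordal supergraph "designated adjacency + the label clique", transported to `Fin (m + k)`;
  `certificate_push`: re-indexing the inner vertices monotonically preserves the certificate on the range;
* `…DiUnfoldingOperations.lean` — GLUING (`mul`) and FORGETTING A LABEL (`sumLabel`) preserve certificates;
* `…DiUnfolding.lean` — the labelled values, the span induction and the closed statement
  `DiUnfolding.close_mem_span_diHomPoly`.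

Def-free helper (`--supports stmt-ValiantsHypothesis-18294`); everything is stated over explicit terms so that
no definition is introduced; nothing here is a named fact.  Honest label: folklore currency change (VH-free);
the stub `stub_lvNarrowSpan` (VH-strength, `…LvNarrowSpanVH`), R1 and VP ≠ VNP are NOT moved.

References: Dawar–Pago–Seppelt 2025 (arXiv:2502.06740) Thm 1.1, §5, Remark p. 17, §7; Diestel, *Graph Theory*
§12.3 Cor. 12.3.9; Courcelle–Engelfriet, *Graph Structure and Monadic Second-Order Logic* (2012) §2.3
(HR algebra of graphs with `k` sources has treewidth `k - 1`).
-/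

noncomputable section

open scoped Classical

-- `Summit.ValiantsHypothesis.ValiantsHypothesis.…` is the tree's single-conjunct layout (Sub = Summit).
set_option linter.dupNamespace false

namespace Summit.ValiantsHypothesis.ValiantsHypothesis.Theorems.DiUnfolding

open Literature.Combinatorics.SimpleGraph (treewidth treewidth_le_of_forall_ncard_higherAdj_le)
open Literature.LinearAlgebra.Matrix.ChordalSparsity (MonotoneTransitive higherAdj)
open Summit.ValiantsHypothesis.ValiantsHypothesis.Theorems

variable {k m : ℕ}

/-! ### The treewidth bound carried by a certificate -/

/-- **A certified labelled pattern has treewidth `≤ k - 1`.**  Vertices `Fin k ⊕ Fin m` (`k` label vertices,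
`m` inner vertices, the inner ones indexed in REVERSE order of creation); `N j` is the set of HIGHER neighbours
allowed for the inner vertex `j` in the chordal supergraph "alive and holding a label when `j` was created"
(`≤ k - 1` of them, all later in the elimination order `inner 0 < inner 1 < ⋯ < labels`, pairwise adjacent,
and containing every pattern neighbour of `j` that is higher); the label vertices form a clique on top.  Then
the elimination-ordering bound (`treewidth_le_of_forall_ncard_higherAdj_le`: a perfect elimination ordering of a
supergraph with higher degrees `≤ k - 1`) gives `tw ≤ k - 1`. [folklore] -/
theorem treewidth_le_of_certificate (E : Multiset ((Fin k ⊕ Fin m) × (Fin k ⊕ Fin m)))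
    (N : Fin m → Finset (Fin k ⊕ Fin m))
    (h1 : ∀ j, (N j).card ≤ k - 1)
    (h2 : ∀ j j', Sum.inr j' ∈ N j → j < j')
    (h3a : ∀ (j : Fin m) (b : Fin k),
      ((Sum.inr j, Sum.inl b) ∈ E ∨ (Sum.inl b, Sum.inr j) ∈ E) → Sum.inl b ∈ N j)
    (h3b : ∀ j j' : Fin m,
      ((Sum.inr j, Sum.inr j') ∈ E ∨ (Sum.inr j', Sum.inr j) ∈ E) → j < j' → Sum.inr j' ∈ N j)
    (h4a : ∀ j j₁ j₂ : Fin m, Sum.inr j₁ ∈ N j → Sum.inr j₂ ∈ N j → j₁ < j₂ → Sum.inr j₂ ∈ N j₁)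
    (h4b : ∀ (j j₁ : Fin m) (b : Fin k), Sum.inr j₁ ∈ N j → Sum.inl b ∈ N j → Sum.inl b ∈ N j₁) :
    treewidth (SimpleGraph.fromRel fun u v : Fin k ⊕ Fin m => ∃ e ∈ E, u = e.1 ∧ v = e.2) ≤ k - 1 := by
  -- transport to `Fin (m + k)`: inner vertices first, label vertices last
  let φ : Fin k ⊕ Fin m ≃ Fin (m + k) := (Equiv.sumComm (Fin k) (Fin m)).trans finSumFinEquiv
  have hφl : ∀ b : Fin k, φ (Sum.inl b) = Fin.natAdd m b := fun b => rfl
  have hφr : ∀ j : Fin m, φ (Sum.inr j) = Fin.castAdd k j := fun j => rfl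
  have hlr : ∀ (j : Fin m) (b : Fin k), φ (Sum.inr j) < φ (Sum.inl b) := by
    intro j b
    rw [hφl, hφr, Fin.lt_def, Fin.val_castAdd, Fin.val_natAdd]
    omega
  rw [← SubThresholdDescent.treewidth_map_equiv E φ]
  -- the chordal supergraph: `S x y` says "`y` is a designated higher neighbour of `x`"
  let S : Fin (m + k) → Fin (m + k) → Prop := fun x y =>
    (∃ b b' : Fin k, b < b' ∧ x = φ (Sum.inl b) ∧ y = φ (Sum.inl b')) ∨
    (∃ (j : Fin m) (z : Fin k ⊕ Fin m), z ∈ N j ∧ x = φ (Sum.inr j) ∧ y = φ z)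
  have hSlt : ∀ x y, S x y → x < y := by
    rintro x y (⟨b, b', hbb', rfl, rfl⟩ | ⟨j, z, hz, rfl, rfl⟩)
    · rw [hφl, hφl]
      exact (Fin.natAdd_lt_natAdd_iff m).2 hbb'
    · rcases z with b | j'
      · exact hlr j b
      · rw [hφr, hφr]
        exact Fin.strictMono_castAdd k (h2 j j' hz)
  set H : SimpleGraph (Fin (m + k)) := SimpleGraph.fromRel S with hH
  have hHadj : ∀ x y, H.Adj x y ↔ x ≠ y ∧ (S x y ∨ S y x) := fun x y => SimpleGraph.fromRel_adj _ _ _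
  have hHlt : ∀ x y, x < y → H.Adj x y → S x y := by
    intro x y hxy h
    rcases ((hHadj x y).1 h).2 with h | h
    · exact h
    · exact absurd (hSlt y x h) (not_lt.2 hxy.le)
  -- (1) the pattern graph is a subgraph
  have hGH : (SimpleGraph.fromRel fun u v : Fin (m + k) =>
      ∃ e ∈ E.map (fun e => (φ e.1, φ e.2)), u = e.1 ∧ v = e.2) ≤ H := by
    have key : ∀ e ∈ E, φ e.1 ≠ φ e.2 → S (φ e.1) (φ e.2) ∨ S (φ e.2) (φ e.1) := by
      rintro ⟨u, v⟩ he hne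
      rcases u with b | j <;> rcases v with b' | j'
      · have hbb' : b ≠ b' := fun h => hne (by rw [h])
        rcases lt_or_gt_of_ne hbb' with h | h
        · exact Or.inl (Or.inl ⟨b, b', h, rfl, rfl⟩)
        · exact Or.inr (Or.inl ⟨b', b, h, rfl, rfl⟩)
      · exact Or.inr (Or.inr ⟨j', Sum.inl b, h3a j' b (Or.inr he), rfl, rfl⟩)
      · exact Or.inl (Or.inr ⟨j, Sum.inl b', h3a j b' (Or.inl he), rfl, rfl⟩)
      · have hjj' : j ≠ j' := fun h => hne (by rw [h])
        rcases lt_or_gt_of_ne hjj' with h | h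
        · exact Or.inl (Or.inr ⟨j, Sum.inr j', h3b j j' (Or.inl he) h, rfl, rfl⟩)
        · exact Or.inr (Or.inr ⟨j', Sum.inr j, h3b j' j (Or.inr he) h, rfl, rfl⟩)
    intro x y hxy
    rw [SimpleGraph.fromRel_adj] at hxy
    rw [hHadj]
    refine ⟨hxy.1, ?_⟩
    rcases hxy.2 with ⟨e', he', hx, hy⟩ | ⟨e', he', hy, hx⟩
    · obtain ⟨e, he, rfl⟩ := Multiset.mem_map.1 he'
      subst hx hy
      exact key e he hxy.1
    · obtain ⟨e, he, rfl⟩ := Multiset.mem_map.1 he'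
      subst hx hy
      exact (key e he (Ne.symm hxy.1)).symm
  -- (2) the order is a perfect elimination ordering of `H`
  have hEm : MonotoneTransitive H.Adj := by
    intro i j l hij hil hjl hHij hHil
    have hSij := hHlt i j hij hHij
    have hSil := hHlt i l hil hHil
    rw [hHadj]
    refine ⟨hjl, ?_⟩
    rcases hSij with ⟨b, b', hbb', hi, rfl⟩ | ⟨j₀, z, hz, hi, rfl⟩
    · rcases hSil with ⟨b₂, b'', hbb'', hi', rfl⟩ | ⟨j₁, z', hz', hi', rfl⟩
      · have hne : b' ≠ b'' := fun h => hjl (by rw [h])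
        rcases lt_or_gt_of_ne hne with h | h
        · exact Or.inl (Or.inl ⟨b', b'', h, rfl, rfl⟩)
        · exact Or.inr (Or.inl ⟨b'', b', h, rfl, rfl⟩)
      · exact absurd (hi.symm.trans hi') (φ.injective.ne Sum.inl_ne_inr)
    · rcases hSil with ⟨b₂, b'', hbb'', hi', rfl⟩ | ⟨j₁, z', hz', hi', rfl⟩
      · exact absurd (hi'.symm.trans hi) (φ.injective.ne Sum.inl_ne_inr)
      · have hj : j₁ = j₀ := Sum.inr_injective (φ.injective (hi'.symm.trans hi))
        subst hj
        have hzz' : z ≠ z' := fun h => hjl (by rw [h])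
        rcases z with b | a₁ <;> rcases z' with b' | a₂
        · have hne : b ≠ b' := fun h => hzz' (by rw [h])
          rcases lt_or_gt_of_ne hne with h | h
          · exact Or.inl (Or.inl ⟨b, b', h, rfl, rfl⟩)
          · exact Or.inr (Or.inl ⟨b', b, h, rfl, rfl⟩)
        · exact Or.inr (Or.inr ⟨a₂, Sum.inl b, h4b j₁ a₂ b hz' hz, rfl, rfl⟩)
        · exact Or.inl (Or.inr ⟨a₁, Sum.inl b', h4b j₁ a₁ b' hz hz', rfl, rfl⟩)
        · have hne : a₁ ≠ a₂ := fun h => hzz' (by rw [h])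
          rcases lt_or_gt_of_ne hne with h | h
          · exact Or.inl (Or.inr ⟨a₁, Sum.inr a₂, h4a j₁ a₁ a₂ hz hz' h, rfl, rfl⟩)
          · exact Or.inr (Or.inr ⟨a₂, Sum.inr a₁, h4a j₁ a₂ a₁ hz' hz h, rfl, rfl⟩)
  -- (3) higher degrees are `≤ k - 1`
  have hw : ∀ v, (higherAdj H.Adj v).ncard ≤ k - 1 := by
    intro v
    obtain ⟨x, rfl⟩ := φ.surjective v
    have hsub : higherAdj H.Adj (φ x) ⊆ {w | S (φ x) w} := fun w hw => hHlt _ _ hw.1 hw.2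
    rcases x with b | j₀
    · have hsub' : higherAdj H.Adj (φ (Sum.inl b)) ⊆
          ↑((Finset.univ.erase b).image fun b' : Fin k => φ (Sum.inl b')) := by
        intro w hw
        rcases hsub hw with ⟨b₁, b', hbb', h1, rfl⟩ | ⟨j, z, hz, h1, rfl⟩
        · have hb : b₁ = b := Sum.inl_injective (φ.injective h1.symm)
          subst hb
          rw [Finset.coe_image]
          exact ⟨b', by simp [ne_of_gt hbb'], rfl⟩
        · exact absurd h1 (φ.injective.ne Sum.inl_ne_inr)
      calc (higherAdj H.Adj (φ (Sum.inl b))).ncard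
          ≤ (↑((Finset.univ.erase b).image fun b' : Fin k => φ (Sum.inl b')) : Set (Fin (m + k))).ncard :=
            Set.ncard_le_ncard hsub'
        _ = ((Finset.univ.erase b).image fun b' : Fin k => φ (Sum.inl b')).card := Set.ncard_coe_finset _
        _ ≤ (Finset.univ.erase b).card := Finset.card_image_le
        _ = k - 1 := by rw [Finset.card_erase_of_mem (Finset.mem_univ b), Finset.card_univ, Fintype.card_fin]
    · have hsub' : higherAdj H.Adj (φ (Sum.inr j₀)) ⊆ ↑((N j₀).image φ) := by
        intro w hw
        rcases hsub hw with ⟨b₁, b', hbb', h1, rfl⟩ | ⟨j, z, hz, h1, rfl⟩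
        · exact absurd h1.symm (φ.injective.ne Sum.inl_ne_inr)
        · have hj : j = j₀ := Sum.inr_injective (φ.injective h1.symm)
          subst hj
          rw [Finset.coe_image]
          exact ⟨z, hz, rfl⟩
      calc (higherAdj H.Adj (φ (Sum.inr j₀))).ncard
          ≤ (↑((N j₀).image φ) : Set (Fin (m + k))).ncard := Set.ncard_le_ncard hsub'
        _ = ((N j₀).image φ).card := Set.ncard_coe_finset _
        _ ≤ (N j₀).card := Finset.card_image_le
        _ ≤ k - 1 := h1 j₀
  exact treewidth_le_of_forall_ncard_higherAdj_le hGH hEm hw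


/-! ### Pushing a certificate along a re-indexing of the inner vertices -/

/-- Pushing a certified labelled pattern forward along a strictly monotone re-indexing `f` of its inner
vertices (labels fixed, `Sum.map id f`) preserves the certificate on the range of `f`. [folklore] -/
theorem certificate_push {m' : ℕ} (E : Multiset ((Fin k ⊕ Fin m) × (Fin k ⊕ Fin m)))
    (N : Fin m → Finset (Fin k ⊕ Fin m))
    (h1 : ∀ j, (N j).card ≤ k - 1)
    (h2 : ∀ j j', Sum.inr j' ∈ N j → j < j')
    (h3a : ∀ (j : Fin m) (b : Fin k),
      ((Sum.inr j, Sum.inl b) ∈ E ∨ (Sum.inl b, Sum.inr j) ∈ E) → Sum.inl b ∈ N j)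
    (h3b : ∀ j j' : Fin m,
      ((Sum.inr j, Sum.inr j') ∈ E ∨ (Sum.inr j', Sum.inr j) ∈ E) → j < j' → Sum.inr j' ∈ N j)
    (h4a : ∀ j j₁ j₂ : Fin m, Sum.inr j₁ ∈ N j → Sum.inr j₂ ∈ N j → j₁ < j₂ → Sum.inr j₂ ∈ N j₁)
    (h4b : ∀ (j j₁ : Fin m) (b : Fin k), Sum.inr j₁ ∈ N j → Sum.inl b ∈ N j → Sum.inl b ∈ N j₁)
    (f : Fin m → Fin m') (hf : StrictMono f) (N' : Fin m' → Finset (Fin k ⊕ Fin m'))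
    (hN' : ∀ j, N' (f j) = (N j).image (Sum.map id f)) :
    (∀ j, (N' (f j)).card ≤ k - 1) ∧
    (∀ j j', Sum.inr j' ∈ N' (f j) → f j < j') ∧
    (∀ (j : Fin m') (b : Fin k),
      ((Sum.inr j, Sum.inl b) ∈ E.map (Prod.map (Sum.map id f) (Sum.map id f)) ∨
        (Sum.inl b, Sum.inr j) ∈ E.map (Prod.map (Sum.map id f) (Sum.map id f))) → Sum.inl b ∈ N' j) ∧
    (∀ j j' : Fin m',
      ((Sum.inr j, Sum.inr j') ∈ E.map (Prod.map (Sum.map id f) (Sum.map id f)) ∨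
        (Sum.inr j', Sum.inr j) ∈ E.map (Prod.map (Sum.map id f) (Sum.map id f))) → j < j' →
        Sum.inr j' ∈ N' j) ∧
    (∀ (j : Fin m) (j₁ j₂ : Fin m'), Sum.inr j₁ ∈ N' (f j) → Sum.inr j₂ ∈ N' (f j) → j₁ < j₂ →
      Sum.inr j₂ ∈ N' j₁) ∧
    (∀ (j : Fin m) (j₁ : Fin m') (b : Fin k), Sum.inr j₁ ∈ N' (f j) → Sum.inl b ∈ N' (f j) →
      Sum.inl b ∈ N' j₁) := by
  -- inversion of the vertex map `Sum.map id f`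
  have hιl : ∀ (x : Fin k ⊕ Fin m) (b : Fin k), Sum.map id f x = Sum.inl b → x = Sum.inl b := by
    rintro (b' | j) b h
    · simpa using h
    · simp at h
  have hιr : ∀ (x : Fin k ⊕ Fin m) (j' : Fin m'), Sum.map id f x = Sum.inr j' →
      ∃ j, x = Sum.inr j ∧ j' = f j := by
    rintro (b | j) j' h
    · simp at h
    · exact ⟨j, rfl, by simpa using h.symm⟩
  have hmemN : ∀ (j : Fin m) (y : Fin k ⊕ Fin m'), y ∈ N' (f j) ↔ ∃ x ∈ N j, Sum.map id f x = y := by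
    intro j y
    rw [hN', Finset.mem_image]
  have hmemE : ∀ x y : Fin k ⊕ Fin m', (x, y) ∈ E.map (Prod.map (Sum.map id f) (Sum.map id f)) →
      ∃ u v, (u, v) ∈ E ∧ Sum.map id f u = x ∧ Sum.map id f v = y := by
    intro x y h
    obtain ⟨⟨u, v⟩, he, huv⟩ := Multiset.mem_map.1 h
    simp only [Prod.map_apply, Prod.mk.injEq] at huv
    exact ⟨u, v, he, huv.1, huv.2⟩
  refine ⟨?_, ?_, ?_, ?_, ?_, ?_⟩
  · intro j
    rw [hN']
    exact Finset.card_image_le.trans (h1 j)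
  · intro j j' hj'
    obtain ⟨x, hx, hxj'⟩ := (hmemN j _).1 hj'
    obtain ⟨j₀, rfl, rfl⟩ := hιr x j' hxj'
    exact hf (h2 j j₀ hx)
  · intro j b h
    rcases h with h | h
    · obtain ⟨u, v, he, hu, hv⟩ := hmemE _ _ h
      obtain ⟨j₀, rfl, rfl⟩ := hιr u j hu
      obtain rfl := hιl v b hv
      exact (hmemN j₀ _).2 ⟨Sum.inl b, h3a j₀ b (Or.inl he), rfl⟩
    · obtain ⟨u, v, he, hu, hv⟩ := hmemE _ _ h
      obtain rfl := hιl u b hu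
      obtain ⟨j₀, rfl, rfl⟩ := hιr v j hv
      exact (hmemN j₀ _).2 ⟨Sum.inl b, h3a j₀ b (Or.inr he), rfl⟩
  · intro j j' h hjj'
    rcases h with h | h
    · obtain ⟨u, v, he, hu, hv⟩ := hmemE _ _ h
      obtain ⟨j₀, rfl, rfl⟩ := hιr u j hu
      obtain ⟨j₁, rfl, rfl⟩ := hιr v j' hv
      exact (hmemN j₀ _).2 ⟨Sum.inr j₁, h3b j₀ j₁ (Or.inl he) (hf.lt_iff_lt.1 hjj'), rfl⟩
    · obtain ⟨u, v, he, hu, hv⟩ := hmemE _ _ h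
      obtain ⟨j₁, rfl, rfl⟩ := hιr u j' hu
      obtain ⟨j₀, rfl, rfl⟩ := hιr v j hv
      exact (hmemN j₀ _).2 ⟨Sum.inr j₁, h3b j₀ j₁ (Or.inr he) (hf.lt_iff_lt.1 hjj'), rfl⟩
  · intro j j₁ j₂ hj₁ hj₂ hlt
    obtain ⟨x₁, hx₁, hx₁j⟩ := (hmemN j _).1 hj₁
    obtain ⟨i₁, rfl, rfl⟩ := hιr x₁ j₁ hx₁j
    obtain ⟨x₂, hx₂, hx₂j⟩ := (hmemN j _).1 hj₂
    obtain ⟨i₂, rfl, rfl⟩ := hιr x₂ j₂ hx₂j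
    exact (hmemN i₁ _).2 ⟨Sum.inr i₂, h4a j i₁ i₂ hx₁ hx₂ (hf.lt_iff_lt.1 hlt), rfl⟩
  · intro j j₁ b hj₁ hb
    obtain ⟨x₁, hx₁, hx₁j⟩ := (hmemN j _).1 hj₁
    obtain ⟨i₁, rfl, rfl⟩ := hιr x₁ j₁ hx₁j
    obtain ⟨x, hx, hxb⟩ := (hmemN j _).1 hb
    obtain rfl := hιl x b hxb
    exact (hmemN i₁ _).2 ⟨Sum.inl b, h4b j i₁ b hx₁ hx, rfl⟩

end Summit.ValiantsHypothesis.ValiantsHypothesis.Theorems.DiUnfolding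

end
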